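import Literature.NumberTheory.IwasawaTheory.Greenberg2006.LocalEulerPoincareCorank
import Summits.BirchSwinnertonDyer.Rank1Residual.GaloisImage.LocalEulerPoincareCharacteristicHolds
import HarnessLib

/-!
# Route `SignedBaseChange`, crux `AnticyclotomicEisensteinDivisibility` (stmt-BirchSwinnertonDyer-20727),
# line `bdpline`, stub `stub_namedFactsSS`: the named fact
# `Greenberg2006.prop42_localEulerPoincareCorank` (Greenberg 2006 Prop. 4.2, the LOCAL
# Euler–Poincaré `Λ`-corank formula) is a THEOREM of the tree

Width seat `bsd-line-sbc-p1-w2` gen 8 (D-0154 KEY row 7), `--supports stmt-BirchSwinnertonDyer-20727`.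
The registered stub `stub_namedFactsSS` of the line `bdpline` (skeleton v27) lists, among its
Greenberg conjuncts, `Literature.NumberTheory.IwasawaTheory.Greenberg2006.prop42_localEulerPoincareCorank`
(R. Greenberg, *On the structure of certain Galois cohomology groups* (2006), Prop. 4.2:
`Σ_{i≤2} (−1)ⁱ corank_Λ Hⁱ(K_v, 𝒟) = −corank_Λ(𝒟)·[K_v:ℚ_p]` for `v ∣ p`, `= 0` for `v ∤ p`).
The Literature file `Greenberg2006/LocalEulerPoincareCorank.lean` proves it from Tate's local
Euler–Poincaré characteristic formula (`localEulerPoincareCharacteristic F`, Milne ADT I Thm. 2.8),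
which the tree proves Summits-side (`localEulerPoincareCharacteristic_holds`, cell `b2b-bsdres`).
Composing the two DISCHARGES the named fact unconditionally:
`Literature.NumberTheory.IwasawaTheory.Greenberg2006.prop42_localEulerPoincareCorank_holds`
(root-qualified, next to the fact's name, as for `localEulerPoincareCharacteristic_holds`).  Effect on the line: the Greenberg
conjuncts of `stub_namedFactsSS` that remain NAMED FACTS are `Greenberg2016.prop411/prop422`,
`Greenberg2006.prop41`, and `Greenberg2006.prop32` (itself reduced to NSW (8.3.20) by the LEAD g6 /
w3 g6 / w4 g6 files).  HONEST FRAMING: a discharge of one published input; closes nothing by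
itself; BSD / the crux are NOT proved here.

References: [Greenberg2006] §4 A Prop. 4.2 (p. 368); [MilneADT2006] I Thm. 2.8.
-/

noncomputable section

namespace Summit.BirchSwinnertonDyer.BirchSwinnertonDyer.Theorems.SignedBaseChangeAcDivLocalEulerPoincareCorank

/-- **Greenberg 2006, Prop. 4.2 — the local Euler–Poincaré `Λ`-corank formula — DISCHARGED**:
the named fact `Greenberg2006.prop42_localEulerPoincareCorank` holds (Tate's local Euler–Poincaré
characteristic `localEulerPoincareCharacteristic_holds` fed into
`Greenberg2006.prop42_of_localEulerPoincareCharacteristic`).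
[cite: Greenberg2006, §4 A Prop. 4.2 (p. 368 L14–22)] [cite: MilneADT2006, Ch. I §2, Thm. 2.8] -/
theorem _root_.Literature.NumberTheory.IwasawaTheory.Greenberg2006.prop42_localEulerPoincareCorank_holds :
    Literature.NumberTheory.IwasawaTheory.Greenberg2006.prop42_localEulerPoincareCorank :=
  Literature.NumberTheory.IwasawaTheory.Greenberg2006.prop42_of_localEulerPoincareCharacteristic
    fun F _ _ _ _ _ =>
      Literature.NumberTheory.GaloisRepresentations.localEulerPoincareCharacteristic_holds F

end Summit.BirchSwinnertonDyer.BirchSwinnertonDyer.Theorems.SignedBaseChangeAcDivLocalEulerPoincareCorank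

end
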